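import Mathlib

/-!
# n-period contraction gives the one-period resolvent (solo-blind kernel #187)

Paper `steady-zeroth-law.md` §24.107 / PLAN §107 (d).  The OUTER theorem of the (P⁺)_F programme proves, for `P ≥ P*`, that some
POWER of the (frame-reduced) period map is a contraction, `‖M^n‖ < 1` with `n = n(P) = O(1 + log P/√P)` periods, because the enhanced
dissipation needs `n` periods to beat the polynomial transient constants.  The assembly step from there to the certified quantity
`‖(1 - M)⁻¹‖` is the telescoping identity `(1 - M) Σ_{j<n} M^j = 1 - M^n`: the one-period resolvent exists and
`‖(1 - M)⁻¹‖ ≤ (Σ_{j<n} ‖M^j‖) · ‖(1 - M^n)⁻¹‖`, polynomial in `P` since each `‖M^j‖` is.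

* `soloBlind_oneSub_inverse_of_pow` — purely algebraic: a two-sided inverse `S` of `1 - M^n` yields the two-sided inverse
  `(Σ_{j<n} M^j) S` of `1 - M` (any ring);
* `soloBlind_power_resolvent` — in a complete normed ring, `‖M^n‖ < 1` ⇒ `1 - M` invertible with
  `‖R‖ ≤ (Σ_{j<n} ‖M^j‖)(‖1‖ - 1 + (1 - ‖M^n‖)⁻¹)` (the Mathlib form of the Neumann bound, not assuming `‖1‖ = 1`);
* `soloBlind_power_resolvent_half` — the form used: `‖M^n‖ ≤ 1/2`, `‖1‖ = 1` ⇒ `‖R‖ ≤ 2 Σ_{j<n} ‖M^j‖`.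
-/

namespace Summit.AnomalousDissipation.AnomalousDissipation.Theorems

open Finset

/-- Algebra: if `S` is a two-sided inverse of `1 - M^n` then `(Σ_{j<n} M^j) S` is a two-sided inverse of `1 - M`. -/
theorem soloBlind_oneSub_inverse_of_pow {A : Type*} [Ring A] (M S : A) (n : ℕ)
    (hS1 : (1 - M ^ n) * S = 1) (hS2 : S * (1 - M ^ n) = 1) :
    (1 - M) * ((∑ j ∈ range n, M ^ j) * S) = 1 ∧ ((∑ j ∈ range n, M ^ j) * S) * (1 - M) = 1 := by
  have hG1 : (1 - M) * ∑ j ∈ range n, M ^ j = 1 - M ^ n := mul_neg_geom_sum M n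
  have hG2 : (∑ j ∈ range n, M ^ j) * (1 - M) = 1 - M ^ n := geom_sum_mul_neg M n
  -- `1 - M` commutes with `1 - M^n`, hence with its inverse `S`
  have hcomm : (1 - M) * (1 - M ^ n) = (1 - M ^ n) * (1 - M) :=
    ((Commute.one_left _).sub_left ((Commute.one_right M).sub_right (Commute.self_pow M n))).eq
  have hSc : S * (1 - M) = (1 - M) * S := by
    calc S * (1 - M) = S * (1 - M) * ((1 - M ^ n) * S) := by rw [hS1, mul_one]
      _ = S * ((1 - M) * (1 - M ^ n)) * S := by simp only [mul_assoc]
      _ = S * ((1 - M ^ n) * (1 - M)) * S := by rw [hcomm]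
      _ = (S * (1 - M ^ n)) * ((1 - M) * S) := by simp only [mul_assoc]
      _ = (1 - M) * S := by rw [hS2, one_mul]
  constructor
  · rw [← mul_assoc, hG1, hS1]
  · rw [mul_assoc, hSc, ← mul_assoc, hG2, hS1]

/-- **n-period contraction ⇒ one-period resolvent.**  In a complete normed ring, if `‖M^n‖ < 1` then `1 - M` has a two-sided inverse `R`
with `‖R‖ ≤ (Σ_{j<n} ‖M^j‖) · (‖1‖ - 1 + (1 - ‖M^n‖)⁻¹)`. -/
theorem soloBlind_power_resolvent {A : Type*} [NormedRing A] [CompleteSpace A] (M : A) (n : ℕ) (hMn : ‖M ^ n‖ < 1) :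
    ∃ R : A, (1 - M) * R = 1 ∧ R * (1 - M) = 1 ∧
      ‖R‖ ≤ (∑ j ∈ range n, ‖M ^ j‖) * (‖(1 : A)‖ - 1 + (1 - ‖M ^ n‖)⁻¹) := by
  set S : A := ∑' i : ℕ, (M ^ n) ^ i with hSdef
  have hS1 : (1 - M ^ n) * S = 1 := mul_neg_geom_series (M ^ n) hMn
  have hS2 : S * (1 - M ^ n) = 1 := geom_series_mul_neg (M ^ n) hMn
  obtain ⟨h1, h2⟩ := soloBlind_oneSub_inverse_of_pow M S n hS1 hS2
  refine ⟨(∑ j ∈ range n, M ^ j) * S, h1, h2, ?_⟩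
  calc ‖(∑ j ∈ range n, M ^ j) * S‖ ≤ ‖∑ j ∈ range n, M ^ j‖ * ‖S‖ := norm_mul_le _ _
    _ ≤ (∑ j ∈ range n, ‖M ^ j‖) * (‖(1 : A)‖ - 1 + (1 - ‖M ^ n‖)⁻¹) := by
        apply mul_le_mul (norm_sum_le _ _) (tsum_geometric_le_of_norm_lt_one (M ^ n) hMn) (norm_nonneg _)
        exact sum_nonneg (fun _ _ => norm_nonneg _)

/-- The form used by the outer theorem (`‖1‖ = 1`, `‖M^n‖ ≤ 1/2`): `‖(1 - M)⁻¹‖ ≤ 2 Σ_{j<n} ‖M^j‖`. -/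
theorem soloBlind_power_resolvent_half {A : Type*} [NormedRing A] [NormOneClass A] [CompleteSpace A] (M : A) (n : ℕ)
    (hMn : ‖M ^ n‖ ≤ 1 / 2) :
    ∃ R : A, (1 - M) * R = 1 ∧ R * (1 - M) = 1 ∧ ‖R‖ ≤ 2 * ∑ j ∈ range n, ‖M ^ j‖ := by
  have hlt : ‖M ^ n‖ < 1 := by linarith
  obtain ⟨R, h1, h2, hR⟩ := soloBlind_power_resolvent M n hlt
  refine ⟨R, h1, h2, hR.trans ?_⟩
  have hsum : 0 ≤ ∑ j ∈ range n, ‖M ^ j‖ := sum_nonneg (fun _ _ => norm_nonneg _)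
  have hinv : (1 - ‖M ^ n‖)⁻¹ ≤ 2 := by
    rw [inv_le_comm₀ (by linarith) (by norm_num)]; linarith
  rw [norm_one]
  nlinarith

end Summit.AnomalousDissipation.AnomalousDissipation.Theorems
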